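import Summits.CriticalPhenomena.PercolationContinuityZ3.Theorems.PercNearOneGluingNoHeavyLowerTailThreePointProductFormFibreFlatPreimage
import HarnessLib

/-!
# The product form in the fibre language: THE BRANCH FLIP and (T1) `#bad + w ≤ #J^{s|c}` (Sahi programme, prover prim-sahi-p2 gen 56)

Support file (`--supports stmt-CriticalPhenomena-4575`, helper); continues `…ThreePointProductFormFibreFlatPreimage` (`#J = #bad + w + w′ + j`)
and `…FibreAntithetic` (A/Y lemma).  Standard axioms, no sorries, no named facts, no definitions.  Memo
`run/shared/lean/prim/prim-sahi/FROM-prim-sahi-p2-gen56-REFINED-PRODUCT-FORM.md` §5; PROOF-E3 (66f).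
THE BRANCH FLIP: for `z : α → Bool` and `a ≠ c` let `z^{−c} := fun l => z l && !decide (c ∈ ends l)` (close the labels at `c`), `A₀ := C_a(z^{−c})`
(the branch of `a` at `c`) and `Φ z := fun l => if (∃ v ∈ ends l, R z^{−c} a v) then !z l else z l` (complement the labels touching `A₀`).
* `branchFlip_injective` — `Φ` is injective (`A₀ = C_a(((Φ z)‾)^{−c})`, `reachable_closeAt_iff_recover`).
* `reachable_branchFlip` — `s ↔ c` in `z` and `a ↮ s` in `z^{−c}` (c separates s from a) ⟹ `s ↔ c` in `Φ z` (exit lemma `exists_exit_label`).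
* `reachable_compl_branchFlip` — `a ↔ c` in `z` ⟹ `a ↔ c` in `(Φ z)‾`.
* **`card_csep_le`** — `#{a ↔ s, a ↔ c, c separates s from a} ≤ #{u : s ↔ c in u, a ↔ c in ū}` (= `w′ + j`).
* **`card_bad_add_w_le_card_joined_avoiding`** — **(T1)** `#bad + w ≤ #J^{s|c}`, `J^{s|c} := {a ↔ c in z, a ↔ s in z^{−c}}`; 0 exceptions in the
  gen-56 census before the proof; sharper than `#bad + w + w′ ≤ #J`.  [this work] throughout; [folklore] (first-exit arguments);
[cite: Gladkov2024, Conjecture 10.1 (p. 18), arXiv:2408.08457] for CONJECTURE (P) served.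
-/

namespace Summit.CriticalPhenomena.PercolationContinuityZ3.Theorems.ProductFormFibre

open Finset Literature.Probability.Percolation
open Summit.CriticalPhenomena.PercolationContinuityZ3.Theorems.ThreePointCPIClusterSwap (clusterFlip)

variable {V α : Type*}

section BranchFlip

variable (ends : α → Sym2 V) (a c : V) [DecidableEq V]

/-- An open label of `z^{−c}` is an open label of `z`. [folklore] -/
theorem apply_of_closeAt {z : α → Bool} {l : α} (h : (z l && !decide (c ∈ ends l)) = true) : z l = true := by
  rw [Bool.and_eq_true] at h; exact h.1

/-- An open label of `z^{−c}` misses `c`. [folklore] -/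
theorem not_mem_of_closeAt {z : α → Bool} {l : α} (h : (z l && !decide (c ∈ ends l)) = true) : c ∉ ends l := by
  rw [Bool.and_eq_true, Bool.not_eq_true', decide_eq_false_iff_not] at h; exact h.2

/-- A `z`-open label missing `c` is `z^{−c}`-open. [folklore] -/
theorem closeAt_of_apply {z : α → Bool} {l : α} (h : z l = true) (hc : c ∉ ends l) : (z l && !decide (c ∈ ends l)) = true := by
  rw [Bool.and_eq_true, Bool.not_eq_true', decide_eq_false_iff_not]; exact ⟨h, hc⟩

/-- `z^{−c}`-connections are `z`-connections. [folklore] -/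
theorem reachable_of_reachable_closeAt (z : α → Bool) {u v : V}
    (h : (openGraph (labelledOpen ends fun l => z l && !decide (c ∈ ends l))).Reachable u v) :
    (openGraph (labelledOpen ends z)).Reachable u v := by
  refine h.mono ?_
  intro x y hxy
  rw [openGraph_adj] at hxy ⊢
  obtain ⟨⟨l, hl, hle⟩, hne⟩ := hxy
  exact ⟨⟨l, apply_of_closeAt ends c hl, hle⟩, hne⟩

/-- `c` is isolated in `z^{−c}`: `u ↔ c` in `z^{−c}` forces `u = c`. [folklore] -/
theorem eq_of_reachable_closeAt (z : α → Bool) {u : V}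
    (h : (openGraph (labelledOpen ends fun l => z l && !decide (c ∈ ends l))).Reachable u c) : u = c := by
  obtain ⟨p⟩ := h.symm
  cases p with
  | nil => rfl
  | cons h' q' =>
    exfalso
    rw [openGraph_adj] at h'
    obtain ⟨⟨l, hl, hle⟩, -⟩ := h'
    exact not_mem_of_closeAt ends c hl (by rw [hle]; exact Sym2.mem_mk_left _ _)

/-- **Exit lemma.**  If a `z`-walk runs from a vertex `y` of the `z^{−c}`-cluster of `t` to a vertex `u` outside it, then some `z`-open,
`z^{−c}`-closed label (hence a label at `c`) starts in that cluster. [this work] -/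
theorem exists_exit_label (z : α → Bool) {t : V} :
    ∀ {y u : V} (_ : (openGraph (labelledOpen ends z)).Walk y u),
      (openGraph (labelledOpen ends fun l => z l && !decide (c ∈ ends l))).Reachable t y →
      ¬ (openGraph (labelledOpen ends fun l => z l && !decide (c ∈ ends l))).Reachable t u →
      ∃ l, z l = true ∧ c ∈ ends l ∧ ∃ x y' : V, ends l = s(x, y') ∧ x ≠ y' ∧
        (openGraph (labelledOpen ends fun l => z l && !decide (c ∈ ends l))).Reachable t x
  | _, _, .nil, hty, htu => (htu hty).elim
  | y, u, .cons (v := y₁) hadj p, hty, htu => by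
      rw [openGraph_adj] at hadj
      obtain ⟨⟨l, hl, hle⟩, hne⟩ := hadj
      by_cases hcl : c ∈ ends l
      · exact ⟨l, hl, hcl, y, y₁, hle, hne, hty⟩
      · have hadj' : (openGraph (labelledOpen ends fun l => z l && !decide (c ∈ ends l))).Adj y y₁ := by
          rw [openGraph_adj]; exact ⟨⟨l, closeAt_of_apply ends c hl hcl, hle⟩, hne⟩
        exact exists_exit_label z p (hty.trans hadj'.reachable) htu

open Classical in
/-- A `z^{−c}`-walk starting OUTSIDE the branch `A₀ = C_a(z^{−c})` is a walk of the branch flip `Φ z` (its labels do not touch `A₀`). [this work] -/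
theorem reachable_branchFlip_of_walk_outside (z : α → Bool) :
    ∀ {u v : V} (_ : (openGraph (labelledOpen ends fun l => z l && !decide (c ∈ ends l))).Walk u v),
      ¬ (openGraph (labelledOpen ends fun l => z l && !decide (c ∈ ends l))).Reachable a u →
      (openGraph (labelledOpen ends fun l =>
        if (∃ w ∈ ends l, (openGraph (labelledOpen ends fun l' => z l' && !decide (c ∈ ends l'))).Reachable a w)
        then !z l else z l)).Reachable u v
  | _, _, .nil, _ => SimpleGraph.Reachable.refl _
  | u, v, .cons (v := u₁) hadj p, hu => by
      have hadj0 := hadj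
      rw [openGraph_adj] at hadj
      obtain ⟨⟨l, hl, hle⟩, hne⟩ := hadj
      have hu₁ : ¬ (openGraph (labelledOpen ends fun l => z l && !decide (c ∈ ends l))).Reachable a u₁ :=
        fun h => hu (h.trans hadj0.reachable.symm)
      have hnt : ¬ ∃ w ∈ ends l, (openGraph (labelledOpen ends fun l' => z l' && !decide (c ∈ ends l'))).Reachable a w := by
        rintro ⟨w, hw, haw⟩
        rw [hle, Sym2.mem_iff] at hw
        rcases hw with rfl | rfl
        · exact hu haw
        · exact hu₁ haw
      have hadj' : (openGraph (labelledOpen ends fun l =>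
          if (∃ w ∈ ends l, (openGraph (labelledOpen ends fun l' => z l' && !decide (c ∈ ends l'))).Reachable a w)
          then !z l else z l)).Adj u u₁ := by
        rw [openGraph_adj]
        refine ⟨⟨l, ?_, hle⟩, hne⟩
        dsimp only
        rw [if_neg hnt]
        exact apply_of_closeAt ends c hl
      exact hadj'.reachable.trans (reachable_branchFlip_of_walk_outside z p hu₁)

open Classical in
/-- A `z^{−c}`-walk starting INSIDE the branch is a walk of the complement of the branch flip (its labels touch `A₀`, where `(Φ z)‾ = z`). [this work] -/
theorem reachable_compl_branchFlip_of_walk_inside (z : α → Bool) :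
    ∀ {u v : V} (_ : (openGraph (labelledOpen ends fun l => z l && !decide (c ∈ ends l))).Walk u v),
      (openGraph (labelledOpen ends fun l => z l && !decide (c ∈ ends l))).Reachable a u →
      (openGraph (labelledOpen ends fun l =>
        !(if (∃ w ∈ ends l, (openGraph (labelledOpen ends fun l' => z l' && !decide (c ∈ ends l'))).Reachable a w)
          then !z l else z l))).Reachable u v
  | _, _, .nil, _ => SimpleGraph.Reachable.refl _
  | u, v, .cons (v := u₁) hadj p, hu => by
      have hadj0 := hadj
      rw [openGraph_adj] at hadj
      obtain ⟨⟨l, hl, hle⟩, hne⟩ := hadj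
      have ht : ∃ w ∈ ends l, (openGraph (labelledOpen ends fun l' => z l' && !decide (c ∈ ends l'))).Reachable a w :=
        ⟨u, by rw [hle]; exact Sym2.mem_mk_left u u₁, hu⟩
      have hadj' : (openGraph (labelledOpen ends fun l =>
          !(if (∃ w ∈ ends l, (openGraph (labelledOpen ends fun l' => z l' && !decide (c ∈ ends l'))).Reachable a w)
            then !z l else z l))).Adj u u₁ := by
        rw [openGraph_adj]
        refine ⟨⟨l, ?_, hle⟩, hne⟩
        dsimp only
        rw [if_pos ht, Bool.not_not]
        exact apply_of_closeAt ends c hl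
      exact hadj'.reachable.trans (reachable_compl_branchFlip_of_walk_inside z p (hu.trans hadj0.reachable))

open Classical in
/-- **`s ↔ c` survives the branch flip** when `c` separates `s` from `a`: if `s ↔ c` in `z`, `a ↮ s` in `z^{−c}`, `s ≠ c` and `a ≠ c`, then
`s ↔ c` in `Φ z`. [this work] -/
theorem reachable_branchFlip (z : α → Bool) {s : V} (hsc : s ≠ c) (hac : a ≠ c)
    (hz : (openGraph (labelledOpen ends z)).Reachable s c)
    (hsep : ¬ (openGraph (labelledOpen ends fun l => z l && !decide (c ∈ ends l))).Reachable a s) :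
    (openGraph (labelledOpen ends fun l =>
      if (∃ w ∈ ends l, (openGraph (labelledOpen ends fun l' => z l' && !decide (c ∈ ends l'))).Reachable a w)
      then !z l else z l)).Reachable s c := by
  obtain ⟨p⟩ := hz
  have hnot : ¬ (openGraph (labelledOpen ends fun l => z l && !decide (c ∈ ends l))).Reachable s c :=
    fun h => hsc (eq_of_reachable_closeAt ends c z h)
  obtain ⟨l, hl, hcl, x, y', hle, hne, hsx⟩ := exists_exit_label ends c z p (SimpleGraph.Reachable.refl s) hnot
  have hxc : x ≠ c := fun h => hsc (eq_of_reachable_closeAt ends c z (h ▸ hsx))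
  have hy' : y' = c := by
    rw [hle, Sym2.mem_iff] at hcl
    rcases hcl with h | h
    · exact absurd h.symm hxc
    · exact h.symm
  rw [hy'] at hle hne
  have hax : ¬ (openGraph (labelledOpen ends fun l => z l && !decide (c ∈ ends l))).Reachable a x :=
    fun h => hsep (h.trans hsx.symm)
  have h1 : (openGraph (labelledOpen ends fun l =>
      if (∃ w ∈ ends l, (openGraph (labelledOpen ends fun l' => z l' && !decide (c ∈ ends l'))).Reachable a w)
      then !z l else z l)).Reachable s x := by
    obtain ⟨q⟩ := hsx
    exact reachable_branchFlip_of_walk_outside ends a c z q hsep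
  have hnt : ¬ ∃ w ∈ ends l, (openGraph (labelledOpen ends fun l' => z l' && !decide (c ∈ ends l'))).Reachable a w := by
    rintro ⟨w, hw, haw⟩
    rw [hle, Sym2.mem_iff] at hw
    rcases hw with rfl | rfl
    · exact hax haw
    · exact hac (eq_of_reachable_closeAt ends _ z haw)
  have h2 : (openGraph (labelledOpen ends fun l =>
      if (∃ w ∈ ends l, (openGraph (labelledOpen ends fun l' => z l' && !decide (c ∈ ends l'))).Reachable a w)
      then !z l else z l)).Adj x c := by
    rw [openGraph_adj]
    refine ⟨⟨l, ?_, hle⟩, hne⟩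
    dsimp only
    rw [if_neg hnt]; exact hl
  exact h1.trans h2.reachable

open Classical in
/-- **`a ↔ c` in the complement of the branch flip** whenever `a ↔ c` in `z` (`a ≠ c`). [this work] -/
theorem reachable_compl_branchFlip (z : α → Bool) (hac : a ≠ c)
    (hz : (openGraph (labelledOpen ends z)).Reachable a c) :
    (openGraph (labelledOpen ends fun l =>
      !(if (∃ w ∈ ends l, (openGraph (labelledOpen ends fun l' => z l' && !decide (c ∈ ends l'))).Reachable a w)
        then !z l else z l))).Reachable a c := by
  obtain ⟨p⟩ := hz
  have hnot : ¬ (openGraph (labelledOpen ends fun l => z l && !decide (c ∈ ends l))).Reachable a c :=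
    fun h => hac (eq_of_reachable_closeAt ends c z h)
  obtain ⟨l, hl, hcl, x, y', hle, hne, hax⟩ := exists_exit_label ends c z p (SimpleGraph.Reachable.refl a) hnot
  have hxc : x ≠ c := fun h => hac (eq_of_reachable_closeAt ends c z (h ▸ hax))
  have hy' : y' = c := by
    rw [hle, Sym2.mem_iff] at hcl
    rcases hcl with h | h
    · exact absurd h.symm hxc
    · exact h.symm
  rw [hy'] at hle hne
  have h1 : (openGraph (labelledOpen ends fun l =>
      !(if (∃ w ∈ ends l, (openGraph (labelledOpen ends fun l' => z l' && !decide (c ∈ ends l'))).Reachable a w)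
        then !z l else z l))).Reachable a x := by
    obtain ⟨q⟩ := hax
    exact reachable_compl_branchFlip_of_walk_inside ends a c z q (SimpleGraph.Reachable.refl a)
  have ht : ∃ w ∈ ends l, (openGraph (labelledOpen ends fun l' => z l' && !decide (c ∈ ends l'))).Reachable a w :=
    ⟨x, by rw [hle]; exact Sym2.mem_mk_left x c, hax⟩
  have h2 : (openGraph (labelledOpen ends fun l =>
      !(if (∃ w ∈ ends l, (openGraph (labelledOpen ends fun l' => z l' && !decide (c ∈ ends l'))).Reachable a w)
        then !z l else z l))).Adj x c := by
    rw [openGraph_adj]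
    refine ⟨⟨l, ?_, hle⟩, hne⟩
    dsimp only
    rw [if_pos ht, Bool.not_not]; exact hl
  exact h1.trans h2.reachable

open Classical in
/-- The branch of `a` at `c` computed from `((Φ z)‾)^{−c}` contains the branch of `z`. [this work] -/
theorem reachable_recover_of_walk (z : α → Bool) :
    ∀ {u v : V} (_ : (openGraph (labelledOpen ends fun l => z l && !decide (c ∈ ends l))).Walk u v),
      (openGraph (labelledOpen ends fun l => z l && !decide (c ∈ ends l))).Reachable a u →
      (openGraph (labelledOpen ends fun l =>
        (!(if (∃ w ∈ ends l, (openGraph (labelledOpen ends fun l' => z l' && !decide (c ∈ ends l'))).Reachable a w)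
          then !z l else z l)) && !decide (c ∈ ends l))).Reachable u v
  | _, _, .nil, _ => SimpleGraph.Reachable.refl _
  | u, v, .cons (v := u₁) hadj p, hu => by
      have hadj0 := hadj
      rw [openGraph_adj] at hadj
      obtain ⟨⟨l, hl, hle⟩, hne⟩ := hadj
      have ht : ∃ w ∈ ends l, (openGraph (labelledOpen ends fun l' => z l' && !decide (c ∈ ends l'))).Reachable a w :=
        ⟨u, by rw [hle]; exact Sym2.mem_mk_left u u₁, hu⟩
      have hadj' : (openGraph (labelledOpen ends fun l =>
        (!(if (∃ w ∈ ends l, (openGraph (labelledOpen ends fun l' => z l' && !decide (c ∈ ends l'))).Reachable a w)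
          then !z l else z l)) && !decide (c ∈ ends l))).Adj u u₁ := by
        rw [openGraph_adj]
        refine ⟨⟨l, ?_, hle⟩, hne⟩
        dsimp only
        rw [if_pos ht, Bool.not_not]
        exact hl
      exact hadj'.reachable.trans (reachable_recover_of_walk z p (hu.trans hadj0.reachable))

open Classical in
/-- Conversely, the branch computed from `((Φ z)‾)^{−c}` is contained in the branch of `z`. [this work] -/
theorem reachable_of_recover_walk (z : α → Bool) :
    ∀ {u v : V} (_ : (openGraph (labelledOpen ends fun l =>
        (!(if (∃ w ∈ ends l, (openGraph (labelledOpen ends fun l' => z l' && !decide (c ∈ ends l'))).Reachable a w)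
          then !z l else z l)) && !decide (c ∈ ends l))).Walk u v),
      (openGraph (labelledOpen ends fun l => z l && !decide (c ∈ ends l))).Reachable a u →
      (openGraph (labelledOpen ends fun l => z l && !decide (c ∈ ends l))).Reachable a v
  | _, _, .nil, hu => hu
  | u, v, .cons (v := u₁) hadj p, hu => by
      rw [openGraph_adj] at hadj
      obtain ⟨⟨l, hl, hle⟩, hne⟩ := hadj
      have ht : ∃ w ∈ ends l, (openGraph (labelledOpen ends fun l' => z l' && !decide (c ∈ ends l'))).Reachable a w :=
        ⟨u, by rw [hle]; exact Sym2.mem_mk_left u u₁, hu⟩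
      rw [Bool.and_eq_true] at hl
      obtain ⟨hl1, hl2⟩ := hl
      rw [if_pos ht, Bool.not_not] at hl1
      have hzl : (z l && !decide (c ∈ ends l)) = true := by rw [Bool.and_eq_true]; exact ⟨hl1, hl2⟩
      have hadj' : (openGraph (labelledOpen ends fun l => z l && !decide (c ∈ ends l))).Adj u u₁ := by
        rw [openGraph_adj]; exact ⟨⟨l, hzl, hle⟩, hne⟩
      exact reachable_of_recover_walk z p (hu.trans hadj'.reachable)

open Classical in
/-- **The branch of `a` at `c` is determined by the branch flip**: `C_a(z^{−c}) = C_a(((Φ z)‾)^{−c})`. [this work] -/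
theorem reachable_closeAt_iff_recover (z : α → Bool) (v : V) :
    (openGraph (labelledOpen ends fun l => z l && !decide (c ∈ ends l))).Reachable a v ↔
    (openGraph (labelledOpen ends fun l =>
        (!(if (∃ w ∈ ends l, (openGraph (labelledOpen ends fun l' => z l' && !decide (c ∈ ends l'))).Reachable a w)
          then !z l else z l)) && !decide (c ∈ ends l))).Reachable a v := by
  constructor
  · rintro ⟨p⟩; exact reachable_recover_of_walk ends a c z p (SimpleGraph.Reachable.refl a)
  · rintro ⟨p⟩; exact reachable_of_recover_walk ends a c z p (SimpleGraph.Reachable.refl a)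

open Classical in
/-- **The branch flip is injective.** [this work] -/
theorem branchFlip_injective :
    Function.Injective (fun z : α → Bool => fun l =>
      if (∃ w ∈ ends l, (openGraph (labelledOpen ends fun l' => z l' && !decide (c ∈ ends l'))).Reachable a w)
      then !z l else z l) := by
  intro z₁ z₂ h
  have h' := fun l => congrArg (fun f : α → Bool => f l) h
  simp only at h'
  have hbr : ∀ w, (openGraph (labelledOpen ends fun l' => z₁ l' && !decide (c ∈ ends l'))).Reachable a w ↔
      (openGraph (labelledOpen ends fun l' => z₂ l' && !decide (c ∈ ends l'))).Reachable a w := by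
    intro w
    rw [reachable_closeAt_iff_recover ends a c z₁ w, reachable_closeAt_iff_recover ends a c z₂ w]
    have hfun : (fun l => (!(if (∃ w ∈ ends l, (openGraph (labelledOpen ends fun l' => z₁ l' && !decide (c ∈ ends l'))).Reachable a w)
          then !z₁ l else z₁ l)) && !decide (c ∈ ends l)) =
        (fun l => (!(if (∃ w ∈ ends l, (openGraph (labelledOpen ends fun l' => z₂ l' && !decide (c ∈ ends l'))).Reachable a w)
          then !z₂ l else z₂ l)) && !decide (c ∈ ends l)) := by
      funext l; rw [h' l]
    rw [hfun]
  funext l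
  have hl := h' l
  have ht : (∃ w ∈ ends l, (openGraph (labelledOpen ends fun l' => z₁ l' && !decide (c ∈ ends l'))).Reachable a w) ↔
      (∃ w ∈ ends l, (openGraph (labelledOpen ends fun l' => z₂ l' && !decide (c ∈ ends l'))).Reachable a w) := by
    constructor
    · rintro ⟨w, hw, hr⟩; exact ⟨w, hw, (hbr w).1 hr⟩
    · rintro ⟨w, hw, hr⟩; exact ⟨w, hw, (hbr w).2 hr⟩
  by_cases h1 : ∃ w ∈ ends l, (openGraph (labelledOpen ends fun l' => z₁ l' && !decide (c ∈ ends l'))).Reachable a w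
  · have h2 := ht.1 h1
    rw [if_pos h1, if_pos h2] at hl
    exact Bool.not_inj hl
  · have h2 : ¬ ∃ w ∈ ends l, (openGraph (labelledOpen ends fun l' => z₂ l' && !decide (c ∈ ends l'))).Reachable a w :=
      fun h => h1 (ht.2 h)
    rw [if_neg h1, if_neg h2] at hl
    exact hl

variable [Fintype α] [DecidableEq α]

open Classical in
/-- **`#{a ↔ s, a ↔ c, c separates s from a} ≤ #{u : s ↔ c in u, a ↔ c in ū}`** via the branch flip. [this work] -/
theorem card_csep_le (s : V) (hsc : s ≠ c) (hac : a ≠ c) :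
    (univ.filter fun z : α → Bool =>
        ((openGraph (labelledOpen ends z)).Reachable a s ∧ (openGraph (labelledOpen ends z)).Reachable a c) ∧
        ¬ (openGraph (labelledOpen ends fun l => z l && !decide (c ∈ ends l))).Reachable a s).card ≤
    (univ.filter fun u : α → Bool =>
        (openGraph (labelledOpen ends u)).Reachable s c ∧ (openGraph (labelledOpen ends fun l => !u l)).Reachable a c).card := by
  refine Finset.card_le_card_of_injOn (fun z : α → Bool => fun l =>
      if (∃ w ∈ ends l, (openGraph (labelledOpen ends fun l' => z l' && !decide (c ∈ ends l'))).Reachable a w)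
      then !z l else z l) ?_ ?_
  · intro z hz
    rw [Finset.mem_coe, Finset.mem_filter] at hz ⊢
    obtain ⟨-, ⟨has, hzac⟩, hsep⟩ := hz
    refine ⟨Finset.mem_univ _, ?_, ?_⟩
    · exact reachable_branchFlip ends a c z hsc hac (has.symm.trans hzac) hsep
    · exact reachable_compl_branchFlip ends a c z hac hzac
  · intro z₁ _ z₂ _ h
    exact branchFlip_injective ends a c h

open Classical in
/-- **(T1) `#bad + w ≤ #J^{s|c}`.**  For every finite labelled multigraph and `s ≠ c`, `a ≠ c`:
`#bad + #{z ∈ P1 : s ↔ c in ♭z} ≤ #{z : a ↔ c in z, a ↔ s in z^{−c}}` — the configurations joining the apex to `c`, and to `s` by a path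
avoiding `c`.  Proof: `#J = #bad + w + w′ + j` (`…FlatPreimage`), `w′ + j = #{u : s ↔_u c, a ↔_{ū} c}` (A/Y lemma), and the branch flip injects
`J ∖ J^{s|c}` into the latter set. [this work] -/
theorem card_bad_add_w_le_card_joined_avoiding (s : V) (hsc : s ≠ c) (hac : a ≠ c) :
    (univ.filter fun z : α → Bool =>
        (¬ (openGraph (labelledOpen ends z)).Reachable a s ∧ ¬ (openGraph (labelledOpen ends z)).Reachable a c ∧
          ¬ (openGraph (labelledOpen ends z)).Reachable s c) ∧
        (openGraph (labelledOpen ends (clusterFlip ends a fun l => !z l))).Reachable s c).card +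
    (univ.filter fun z : α → Bool =>
        ((openGraph (labelledOpen ends z)).Reachable a s ∧ ¬ (openGraph (labelledOpen ends z)).Reachable a c) ∧
        (openGraph (labelledOpen ends (clusterFlip ends a fun l => !z l))).Reachable s c).card ≤
    (univ.filter fun z : α → Bool =>
        (openGraph (labelledOpen ends z)).Reachable a c ∧
        (openGraph (labelledOpen ends fun l => z l && !decide (c ∈ ends l))).Reachable a s).card := by
  have hid := card_joined_eq_card_bad_add_flat_counts ends a s c
  -- `w′ + j = #{z : a ↔ c in z, s ↔ c in ♭z} = #{u : s ↔ c in u, a ↔ c in ū}`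
  have hsplit : (univ.filter fun z : α → Bool =>
        ((openGraph (labelledOpen ends z)).Reachable a c ∧ ¬ (openGraph (labelledOpen ends z)).Reachable a s) ∧
        (openGraph (labelledOpen ends (clusterFlip ends a fun l => !z l))).Reachable s c).card +
      (univ.filter fun z : α → Bool =>
        ((openGraph (labelledOpen ends z)).Reachable a s ∧ (openGraph (labelledOpen ends z)).Reachable a c) ∧
        (openGraph (labelledOpen ends (clusterFlip ends a fun l => !z l))).Reachable s c).card =
      (univ.filter fun z : α → Bool =>
        (openGraph (labelledOpen ends z)).Reachable a c ∧
        (openGraph (labelledOpen ends (clusterFlip ends a fun l => !z l))).Reachable s c).card := by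
    rw [← Finset.card_filter_add_card_filter_not
      (s := univ.filter fun z : α → Bool =>
        (openGraph (labelledOpen ends z)).Reachable a c ∧
        (openGraph (labelledOpen ends (clusterFlip ends a fun l => !z l))).Reachable s c)
      (fun z : α → Bool => ¬ (openGraph (labelledOpen ends z)).Reachable a s)]
    congr 1
    · congr 1; ext z; simp only [Finset.mem_filter, Finset.mem_univ, true_and]; tauto
    · congr 1; ext z; simp only [Finset.mem_filter, Finset.mem_univ, true_and, not_not]; tauto
  have hAY := card_filter_flat_eq_card_filter_compl ends a
    (fun z => (openGraph (labelledOpen ends z)).Reachable a c)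
    (fun u => (openGraph (labelledOpen ends u)).Reachable s c)
    (fun z z' h => by rw [h c])
  -- `#J = #J^{s|c} + #(J ∖ J^{s|c})`
  have hJ := Finset.card_filter_add_card_filter_not
      (s := univ.filter fun z : α → Bool =>
        (openGraph (labelledOpen ends z)).Reachable a s ∧ (openGraph (labelledOpen ends z)).Reachable a c)
      (fun z : α → Bool => (openGraph (labelledOpen ends fun l => z l && !decide (c ∈ ends l))).Reachable a s)
  have eJ1 : ((univ.filter fun z : α → Bool =>
        (openGraph (labelledOpen ends z)).Reachable a s ∧ (openGraph (labelledOpen ends z)).Reachable a c).filter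
        fun z : α → Bool => (openGraph (labelledOpen ends fun l => z l && !decide (c ∈ ends l))).Reachable a s) =
      (univ.filter fun z : α → Bool =>
        (openGraph (labelledOpen ends z)).Reachable a c ∧
        (openGraph (labelledOpen ends fun l => z l && !decide (c ∈ ends l))).Reachable a s) := by
    ext z
    simp only [Finset.mem_filter, Finset.mem_univ, true_and]
    constructor
    · rintro ⟨⟨-, hac'⟩, h⟩; exact ⟨hac', h⟩
    · rintro ⟨hac', h⟩; exact ⟨⟨reachable_of_reachable_closeAt ends c z h, hac'⟩, h⟩
  have eJ2 : ((univ.filter fun z : α → Bool =>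
        (openGraph (labelledOpen ends z)).Reachable a s ∧ (openGraph (labelledOpen ends z)).Reachable a c).filter
        fun z : α → Bool => ¬ (openGraph (labelledOpen ends fun l => z l && !decide (c ∈ ends l))).Reachable a s) =
      (univ.filter fun z : α → Bool =>
        ((openGraph (labelledOpen ends z)).Reachable a s ∧ (openGraph (labelledOpen ends z)).Reachable a c) ∧
        ¬ (openGraph (labelledOpen ends fun l => z l && !decide (c ∈ ends l))).Reachable a s) := by
    ext z; simp only [Finset.mem_filter, Finset.mem_univ, true_and]
  rw [eJ1, eJ2] at hJ
  have hle := card_csep_le ends a c s hsc hac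
  omega

end BranchFlip

end Summit.CriticalPhenomena.PercolationContinuityZ3.Theorems.ProductFormFibre
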